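import Summits.QuantumFields.BalabanUV.Beta.FP.TowerDoorPeriodisedLinear
import Summits.QuantumFields.BalabanUV.Beta.FP.TowerDoorDefectCovariance
import Summits.QuantumFields.BalabanUV.Beta.FP.TowerDoorDefectLoc
import Summits.QuantumFields.BalabanUV.Beta.FP.TowerDoorUniformDataTorus
import Summits.QuantumFields.BalabanUV.Beta.FP.TorusGaugeCovariancePairing

/-!
# `BalabanUV.Beta.FP.TowerDoorDefectTorusPieces` — road «FP», binder row D1: **(T2)'s SECOND SOCKET, THE PIECES — `perF T ∘ dper T` OF THE WARD-DEFECT KERNEL OF A `T`-PERIODIC GAUGE FUNCTION,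
# PIECE BY PIECE** (an2 g78 A-1 l.68803 (Q-FP-55-1 = YES, the requested shape); an2 PART 70 `TowerDoorPeriodisedLinear` (the `perF∘dper` toolkit) by name.)

WHAT ([folklore] `perZ ∘ dper` bookkeeping BY NAME over an2 PART 62∕64∕68∕70 and road `TowerDoorUniformDataTorus`∕`TorusGaugeCovariancePairing`; generic letters: a blocking `L`, tables
`tabs : SymTables 3 L`, `κ₂`, a coarse box `Mc`, a torus `T` with `T i = L·Mc i` (`hT`), a BOUNDED `T`-PERIODIC gauge function `Λ` (`|Λ| ≤ V`, `Λ (translate T u m) = Λ u`); no `def`,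
no `def … : Prop`, nothing cited, 0 sorry, default heartbeats).
§1 Periodic bookkeeping: `translate_eq_add_zsmul` (`translate T u m = u + L•(Mc∘m)`), `neg_zsmul_eq_period`, `apply_translate₂ ∕ diff_translate ∕ apply_wrapPt` (a periodic `Λ` ignores torus translates and
`wrapPt`), **`sum_tgrad_inl_mul_of_periodic`** (`Σ_s tgrad T (r, inl κ) s · Λ ↑s = Λ (↑r + e_κ) − Λ ↑r` — road `sum_tdelta_mul`).
§2 The bi-localisation letters of the pieces (for PART 70's summability side conditions): `biLoc_gradW` (one bond's term, centre `u`, constant `2V·wM2·C·e^{−δ|u − L•β.1|₁}`),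
`biLoc_rowK ∕ biLoc_colK` (`Λ x·H x w`, `H x w·Λ w` at `(L•β.1, L•β.1)`), `biLoc_M2Z_source_translate` (the source copies `m ↦ M2Z (r,κ) (translate Mc β.1 m, β.2)`, centre `r`, constants
`wM2·C·e^{−δ|translate T (L•β.1) m − r|₁}` — summable by road `summable_exp_l1_translate`).
§3 THE PIECES under `perZ T ∘ dper T` at an entry `(x̄, w̄, a, b)`: **`perZ_dper_rowK ∕ perZ_dper_colK`** (the periodic multiplier comes OUT: `Λ x̄ · perZ T (dper T H) …`, `… · Λ w̄` — PART 70
`perZ_dper_apply` + periodicity), **`perZ_dper_gradK`** — THE GRADIENT SERIES: `perZ T (dper T (x w ↦ Σ'_u (Λ(u+e_κ) − Λ u)·M2Z (u,κ) β x w)) x̄ w̄ a b = Σ_{r : pbox T} (Λ(↑r+e_κ) − Λ ↑r) ·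
perZ T (dper T (X Z ↦ Σ'_m M2Z (↑r,κ) (translate Mc β.1 m, β.2) X Z)) x̄ w̄ a b` (PART 70 `perZ_dper_tsum_of_biLoc` OUT over the bonds; road `tsum_eq_sum_pbox_tsum_translate` splits the bond
lattice into torus representatives × periods; PART 68 `M2Z_translate` + PART 70 `dper_shiftK_period` turn a period translate of the bond into a source translate; `m ↦ −m`; PART 70
`perZ_dper_tsum_of_biLoc` IN over the source copies) — the `hM₂`-shaped kernel of v10 appears.
WHAT THIS IS NOT: not the assembled matrix identity (companion `TowerDoorDefectTorus`), not (T2) at the record, not the `wΦ`-winding; nothing of Bałaban's asserted, valued or discharged;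
0 estimates beyond bookkeeping constants; 0∕4 row-D1 binders (hW, hR, D1Tel, D1Rep); v10 NOT filed; NOT (C1), NOT (T-ID), NOT D1, NEVER «G-an2-4 closed», NOT BetaPertH, NOT continuum, NOT Clay.
HONEST DEPENDENCY (page 1, mandatory): continuum YM on T⁴ ⇐ BetaPertH ∧ nine spine estimates (0/9 proved); BetaPertH ⇐ (D1) ∧ (D4) ∧ CAP+tail;
G-an2-4 gates asym, D1 and NE2/3/4.  HONEST FRAMING (cell contract, verbatim): «discharging `BetaPertH` makes Bałaban's UV stability UNCONDITIONAL —
a real constructive-QFT result; it is NOT the continuum limit and NOT the Clay problem.»  ABSOLUTE RULE (cell charter, verbatim): «No internally-minted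
statement may enter as a cited fact. Every hypothesis is either kernel-proved in this package or a verbatim quotation of a PUBLISHED theorem with page
reference. The manuscript(s) under audit are NOT citable for their own disputed steps — they are the thing under adjudication; programme-internal
(2001/route/tribunal) claims are never citable.»  Road «FP» OWNER, b2b-balaban-beta-d1-p3 gen 55, 2026-08-29.  No existing file touched.
-/

noncomputable section

open scoped BigOperators

namespace Summit.QuantumFields.BalabanUV.Beta.FP.TowerDoorDefectTorusPieces

open Finset
open Literature.MathematicalPhysics.QuantumFieldTheory
open Literature.MathematicalPhysics.QuantumFieldTheory.Balaban1983to89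
open Literature.MathematicalPhysics.QuantumFieldTheory.Balaban1983to89.Beta
open B12Sec2to5 (l1 l1_nonneg)
open B4TorusKernel.MultiPeriod (translate translate_apply)
open B4Sect5Proof (latticeConst latticeConst_nonneg)
open B6Lemma24Torus (pbox)
open AffineAveraging (Site unitVec)
open OneStepResolventKernel (Fib)
open ExpKernelCalculus (MKer BiLoc VertexFamily shiftK l1_sub_symm)
open SecondOrderResponse (LocStencilFM)
open BalabanStepW2 (wM2)
open Summit.QuantumFields.BalabanUV.Beta.SymmetrisedStepJets (SymTables)
open Summit.QuantumFields.BalabanUV.Beta.FP.KernelPeriodisationFib (perZ translate_eq_add)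
open Summit.QuantumFields.BalabanUV.Beta.FP.KernelPeriodisationFibLoc (dper summable_exp_l1_translate)
open Summit.QuantumFields.BalabanUV.Beta.FP.TorusGaugeCovariance (tdelta tgrad tgrad_inl)
open Summit.QuantumFields.BalabanUV.Beta.FP.TorusGaugeCovariancePairing (wrapPt wrapPt_of_mem sum_tdelta_mul)
open Summit.QuantumFields.BalabanUV.Beta.GAN24.KernelPeriodisation (quo translate_wrap_quo)
open Summit.QuantumFields.BalabanUV.Beta.FP.TowerDoorDefectDefs (M2Z)
open Summit.QuantumFields.BalabanUV.Beta.FP.TowerDoorDefectLoc (biLoc_M2Z)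
open Summit.QuantumFields.BalabanUV.Beta.FP.TowerDoorDefectCovariance (M2Z_translate)
open Summit.QuantumFields.BalabanUV.Beta.FP.TowerDoorUniformDataTorus (tsum_eq_sum_pbox_tsum_translate)
open Summit.QuantumFields.BalabanUV.Beta.FP.TowerDoorPeriodisedLinear

variable (L : ℕ) (tabs : SymTables 3 L) (T Mc : Fin (3 + 1) → ℕ)

/-! ## §1 Periodic bookkeeping -/

/-- [folklore] on a torus `T = L·Mc`, a `T`-translate is an `L`-multiple of an `Mc`-translate: `translate T u m = u + L•(Mc∘m)`. -/
theorem translate_eq_add_zsmul (hT : ∀ i, T i = L * Mc i) (u m : Site (3 + 1)) :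
    translate T u m = u + ((L : ℕ) : ℤ) • (fun i => (Mc i : ℤ) * m i) := by
  funext i
  simp only [translate_apply, hT, Nat.cast_mul, Pi.add_apply, Pi.smul_apply, smul_eq_mul]
  ring

/-- [folklore] `−(L•(Mc∘m)) = T∘(−m)` (the shape PART 70 `dper_shiftK_period` reads). -/
theorem neg_zsmul_eq_period (hT : ∀ i, T i = L * Mc i) (m : Site (3 + 1)) :
    -(((L : ℕ) : ℤ) • (fun i => (Mc i : ℤ) * m i)) = fun i => (T i : ℤ) * (-m) i := by
  funext i
  simp only [hT, Nat.cast_mul, Pi.neg_apply, Pi.smul_apply, smul_eq_mul]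
  ring

variable {Λ : Site (3 + 1) → ℝ}

/-- [folklore] a `T`-periodic function ignores two torus translates. -/
theorem apply_translate₂ (hΛ : ∀ u m, Λ (translate T u m) = Λ u) (y t j : Site (3 + 1)) :
    Λ (translate T (translate T y t) j) = Λ y := by rw [hΛ, hΛ]

/-- [folklore] the lattice gradient of a `T`-periodic function is `T`-periodic. -/
theorem diff_translate (hΛ : ∀ u m, Λ (translate T u m) = Λ u) (κ : Fin (3 + 1)) (r m : Site (3 + 1)) :
    Λ (translate T r m + unitVec κ) - Λ (translate T r m) = Λ (r + unitVec κ) - Λ r := by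
  rw [show translate T r m + unitVec κ = translate T (r + unitVec κ) m by rw [translate_eq_add, translate_eq_add]; abel, hΛ, hΛ]

/-- [folklore] a `T`-periodic function ignores `wrapPt`. -/
theorem apply_wrapPt [∀ i, NeZero (T i)] (hΛ : ∀ u m, Λ (translate T u m) = Λ u) (x : Site (3 + 1)) : Λ ((wrapPt T x : ↥(pbox T)) : Site (3 + 1)) = Λ x := by
  conv_rhs => rw [← translate_wrap_quo T x]
  rw [hΛ]; rfl

/-- [folklore] **`sum_tgrad_inl_mul_of_periodic`** — v10's gradient factor on a `T`-periodic function: `Σ_s tgrad T (r, inl κ) s · Λ ↑s = Λ (↑r + e_κ) − Λ ↑r`. -/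
theorem sum_tgrad_inl_mul_of_periodic [∀ i, NeZero (T i)] (hΛ : ∀ u m, Λ (translate T u m) = Λ u) (r : ↥(pbox T)) (κ : Fin (3 + 1)) :
    ∑ s : ↥(pbox T), tgrad T (r, Sum.inl κ) s * Λ (s : Site (3 + 1)) = Λ ((r : Site (3 + 1)) + unitVec κ) - Λ (r : Site (3 + 1)) := by
  simp only [tgrad_inl, sub_mul, Finset.sum_sub_distrib]
  rw [sum_tdelta_mul T _ (fun s : ↥(pbox T) => Λ (s : Site (3 + 1))), sum_tdelta_mul T _ (fun s : ↥(pbox T) => Λ (s : Site (3 + 1))),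
    apply_wrapPt T hΛ, wrapPt_of_mem]

/-! ## §2 The bi-localisation letters of the pieces -/

/-- [folklore] one bond's term of the gradient series: centre `u`, constant `2V·(wM2·C·e^{−δ|u − L•β.1|₁})`, rate `δ`. -/
theorem biLoc_gradW {C δ V : ℝ} (hmix : LocStencilFM L tabs.mixFF C δ) (hV : 0 ≤ V) (hΛb : ∀ u, |Λ u| ≤ V)
    (κ : Fin (3 + 1)) (β : Site (3 + 1) × Fin (3 + 1)) (u : Site (3 + 1)) :
    BiLoc (fun (x w : Site (3 + 1)) (a b : Fib 3) => (Λ (u + unitVec κ) - Λ u) * M2Z L tabs (u, κ) β x w a b) u u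
      (2 * V * (|wM2 3 L 0| * (C * Real.exp (-δ * l1 (u - ((L : ℕ) : ℤ) • β.1))))) δ := by
  intro x w a b
  have h := biLoc_M2Z L tabs hmix u κ β x w a b
  have hc : |Λ (u + unitVec κ) - Λ u| ≤ 2 * V := by
    refine (abs_sub _ _).trans ?_
    have := hΛb (u + unitVec κ); have := hΛb u; linarith
  dsimp only
  rw [abs_mul, mul_assoc (2 * V)]
  exact mul_le_mul hc h (abs_nonneg _) (by linarith [abs_nonneg (Λ (u + unitVec κ) - Λ u)])

/-- [folklore] the row cut `Λ x·H x w` of the commutator is bi-localised at the window with constant `V·C_H`. -/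
theorem biLoc_rowK {C_H δH V : ℝ} (hH : VertexFamily tabs.H L C_H δH) (hV : 0 ≤ V) (hΛb : ∀ u, |Λ u| ≤ V) (β : Site (3 + 1) × Fin (3 + 1)) :
    BiLoc (fun (x w : Site (3 + 1)) (a b : Fib 3) => Λ x * tabs.H β.2 β.1 x w a b) (((L : ℕ) : ℤ) • β.1) (((L : ℕ) : ℤ) • β.1) (V * C_H) δH := by
  intro x w a b
  have h := hH β.2 β.1 x w a b
  dsimp only
  rw [abs_mul, mul_assoc]
  exact mul_le_mul (hΛb x) h (abs_nonneg _) hV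

/-- [folklore] the column cut `H x w·Λ w` of the commutator is bi-localised at the window with constant `V·C_H`. -/
theorem biLoc_colK {C_H δH V : ℝ} (hH : VertexFamily tabs.H L C_H δH) (hV : 0 ≤ V) (hΛb : ∀ u, |Λ u| ≤ V) (β : Site (3 + 1) × Fin (3 + 1)) :
    BiLoc (fun (x w : Site (3 + 1)) (a b : Fib 3) => tabs.H β.2 β.1 x w a b * Λ w) (((L : ℕ) : ℤ) • β.1) (((L : ℕ) : ℤ) • β.1) (V * C_H) δH := by
  intro x w a b
  have h := hH β.2 β.1 x w a b
  dsimp only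
  rw [abs_mul, mul_comm, mul_assoc]
  exact mul_le_mul (hΛb w) h (abs_nonneg _) hV

/-- [folklore] **the source copies of the mixed table at a fixed fine bond `(r, κ)`**: `m ↦ M2Z (r,κ) (translate Mc β.1 m, β.2)` is bi-localised at `(r, r)` with constants
`wM2·C·e^{−δ|translate T (L•β.1) m − r|₁}` (summable in `m`, road `summable_exp_l1_translate`). -/
theorem biLoc_M2Z_source_translate (hT : ∀ i, T i = L * Mc i) {C δ : ℝ} (hmix : LocStencilFM L tabs.mixFF C δ) (r : Site (3 + 1)) (κ : Fin (3 + 1))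
    (β : Site (3 + 1) × Fin (3 + 1)) (m : Site (3 + 1)) :
    BiLoc (M2Z L tabs (r, κ) (translate Mc β.1 m, β.2)) r r
      (|wM2 3 L 0| * C * Real.exp (-δ * l1 (translate T (((L : ℕ) : ℤ) • β.1) m - r))) δ := by
  have h := biLoc_M2Z L tabs hmix r κ (translate Mc β.1 m, β.2)
  have e : ((L : ℕ) : ℤ) • translate Mc β.1 m = translate T (((L : ℕ) : ℤ) • β.1) m := by
    funext i; simp only [translate_apply, hT, Nat.cast_mul, Pi.smul_apply, smul_eq_mul]; ring
  intro x w a b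
  refine (h x w a b).trans (le_of_eq ?_)
  dsimp only
  rw [e, l1_sub_symm r]; ring

/-! ## §3 The pieces under `perZ T ∘ dper T` -/

/-- [folklore] **`perZ_dper_rowK`** — the periodic multiplier comes out of the row cut: `perZ T (dper T (x w ↦ Λ x·H x w)) x̄ w̄ a b = Λ x̄ · perZ T (dper T H) x̄ w̄ a b`. -/
theorem perZ_dper_rowK (hΛ : ∀ u m, Λ (translate T u m) = Λ u) (H : MKer (3 + 1) (Fib 3)) (x w : Site (3 + 1)) (a b : Fib 3) :
    perZ T (dper T (fun (x' w' : Site (3 + 1)) (a' b' : Fib 3) => Λ x' * H x' w' a' b')) x w a b = Λ x * perZ T (dper T H) x w a b := by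
  rw [perZ_dper_apply, perZ_dper_apply]
  simp only [hΛ]
  rw [← tsum_mul_left]; refine tsum_congr fun t => ?_
  rw [← tsum_mul_left]

/-- [folklore] **`perZ_dper_colK`** — … and out of the column cut: `perZ T (dper T (x w ↦ H x w·Λ w)) x̄ w̄ a b = perZ T (dper T H) x̄ w̄ a b · Λ w̄`. -/
theorem perZ_dper_colK (hΛ : ∀ u m, Λ (translate T u m) = Λ u) (H : MKer (3 + 1) (Fib 3)) (x w : Site (3 + 1)) (a b : Fib 3) :
    perZ T (dper T (fun (x' w' : Site (3 + 1)) (a' b' : Fib 3) => H x' w' a' b' * Λ w')) x w a b = perZ T (dper T H) x w a b * Λ w := by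
  rw [perZ_dper_apply, perZ_dper_apply]
  simp only [apply_translate₂ T hΛ]
  rw [← tsum_mul_right]; refine tsum_congr fun t => ?_
  rw [← tsum_mul_right]

/-- [folklore] a period translate of the fine bond is a source translate under `perZ T ∘ dper T`:
`perZ T (dper T (M2Z (translate T r m, κ) β)) = perZ T (dper T (M2Z (r, κ) (β.1 − Mc∘m, β.2)))` (PART 68 `M2Z_translate` + PART 70 `dper_shiftK_period`). -/
theorem perZ_dper_M2Z_translate_bond (hT : ∀ i, T i = L * Mc i) (r m : Site (3 + 1)) (κ : Fin (3 + 1)) (β : Site (3 + 1) × Fin (3 + 1)) :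
    perZ T (dper T (M2Z L tabs (translate T r m, κ) β))
      = perZ T (dper T (M2Z L tabs (r, κ) (β.1 - (fun i => (Mc i : ℤ) * m i), β.2))) := by
  have h := M2Z_translate L tabs r (fun i => (Mc i : ℤ) * m i) κ (β.1 - (fun i => (Mc i : ℤ) * m i), β.2)
  rw [sub_add_cancel] at h
  rw [translate_eq_add_zsmul L T Mc hT, h, neg_zsmul_eq_period L T Mc hT, dper_shiftK_period]

/-- [folklore] **`perZ_dper_gradK` — THE GRADIENT SERIES UNDER `perZ T ∘ dper T`**: for `|Λ| ≤ V`, `Λ` `T`-periodic, (Lmix) at `δ > 0`, `T = L·Mc`: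
`perZ T (dper T (x w ↦ Σ'_u (Λ(u+e_κ) − Λ u)·M2Z (u,κ) β x w)) x̄ w̄ a b = Σ_{r : pbox T} (Λ(↑r + e_κ) − Λ ↑r) · perZ T (dper T (X Z ↦ Σ'_m M2Z (↑r,κ) (translate Mc β.1 m, β.2) X Z)) x̄ w̄ a b`. -/
theorem perZ_dper_gradK [∀ i, NeZero (T i)] (hT : ∀ i, T i = L * Mc i) {C δ V : ℝ} (hmix : LocStencilFM L tabs.mixFF C δ) (hδ : 0 < δ)
    (hV : 0 ≤ V) (hΛb : ∀ u, |Λ u| ≤ V) (hΛ : ∀ u m, Λ (translate T u m) = Λ u)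
    (κ : Fin (3 + 1)) (β : Site (3 + 1) × Fin (3 + 1)) (x w : Site (3 + 1)) (a b : Fib 3) :
    perZ T (dper T (fun (x' w' : Site (3 + 1)) (a' b' : Fib 3) => ∑' u : Site (3 + 1), (Λ (u + unitVec κ) - Λ u) * M2Z L tabs (u, κ) β x' w' a' b')) x w a b
      = ∑ r : ↥(pbox T), (Λ ((r : Site (3 + 1)) + unitVec κ) - Λ (r : Site (3 + 1)))
          * perZ T (dper T (fun (X Z : Site (3 + 1)) (i j : Fib 3) => ∑' m : Site (3 + 1), M2Z L tabs ((r : Site (3 + 1)), κ) (translate Mc β.1 m, β.2) X Z i j)) x w a b := by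
  have hC : 0 ≤ C := hmix.nonneg
  -- Step 1: the bond sum OUT of `perZ ∘ dper` (PART 70), then the scalar out of each term
  have hW := fun u => biLoc_gradW L tabs hmix hV hΛb κ β u
  have hCs : Summable (fun u : Site (3 + 1) => 2 * V * (|wM2 3 L 0| * (C * Real.exp (-δ * l1 (u - ((L : ℕ) : ℤ) • β.1))))) := by
    have hs := (ExpKernelCalculus.summable_exp_shift' hδ (((L : ℕ) : ℤ) • β.1)).mul_left (2 * V * (|wM2 3 L 0| * C))
    refine hs.congr fun u => ?_; ring
  rw [perZ_dper_tsum_of_biLoc T hW (fun u => by positivity) hδ hCs x w a b]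
  have hP : ∀ u : Site (3 + 1), perZ T (dper T (fun (x' w' : Site (3 + 1)) (a' b' : Fib 3) => (Λ (u + unitVec κ) - Λ u) * M2Z L tabs (u, κ) β x' w' a' b')) x w a b
      = (Λ (u + unitVec κ) - Λ u) * perZ T (dper T (M2Z L tabs (u, κ) β)) x w a b := fun u => perZ_dper_const_mul T _ _ x w a b
  simp only [hP]
  -- Step 2: the bond lattice = torus representatives × periods
  have hsum : Summable (fun u : Site (3 + 1) => (Λ (u + unitVec κ) - Λ u) * perZ T (dper T (M2Z L tabs (u, κ) β)) x w a b) := by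
    refine Summable.of_norm_bounded (hCs.mul_right (latticeConst (3 + 1) δ * latticeConst (3 + 1) δ)) (fun u => ?_)
    rw [Real.norm_eq_abs, abs_mul]
    have h1 : |Λ (u + unitVec κ) - Λ u| ≤ 2 * V := by
      refine (abs_sub _ _).trans ?_
      have := hΛb (u + unitVec κ); have := hΛb u; linarith
    have h2 := abs_perZ_dper_le_of_biLoc T (biLoc_M2Z L tabs hmix u κ β) (by positivity) hδ x w a b
    calc |Λ (u + unitVec κ) - Λ u| * |perZ T (dper T (M2Z L tabs (u, κ) β)) x w a b|
        ≤ (2 * V) * (|wM2 3 L 0| * (C * Real.exp (-δ * l1 (u - ((L : ℕ) : ℤ) • β.1))) * (latticeConst (3 + 1) δ * latticeConst (3 + 1) δ)) :=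
          mul_le_mul h1 h2 (abs_nonneg _) (by linarith [abs_nonneg (Λ (u + unitVec κ) - Λ u)])
      _ = _ := by ring
  rw [tsum_eq_sum_pbox_tsum_translate T hsum]
  refine Finset.sum_congr rfl fun r _ => ?_
  -- Step 3: along the periods the gradient factor is constant and the bond translate becomes a source translate
  simp only [diff_translate T hΛ, perZ_dper_M2Z_translate_bond L tabs T Mc hT]
  rw [tsum_mul_left]
  congr 1
  -- Step 4: `m ↦ −m`, then the source copies back INSIDE `perZ ∘ dper` (PART 70)
  have hneg : (∑' m : Site (3 + 1), perZ T (dper T (M2Z L tabs ((r : Site (3 + 1)), κ) (β.1 - (fun i => (Mc i : ℤ) * m i), β.2))) x w a b)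
      = ∑' m : Site (3 + 1), perZ T (dper T (M2Z L tabs ((r : Site (3 + 1)), κ) (translate Mc β.1 m, β.2))) x w a b := by
    rw [← (Equiv.neg (Site (3 + 1))).tsum_eq]
    refine tsum_congr fun m => ?_
    have e : (β.1 - fun i => (Mc i : ℤ) * ((Equiv.neg (Site (3 + 1))) m) i) = translate Mc β.1 m := by
      funext i; simp only [Equiv.neg_apply, translate_apply, Pi.sub_apply, Pi.neg_apply]; ring
    rw [e]
  rw [hneg]
  have hW' := fun m => biLoc_M2Z_source_translate L tabs T Mc hT hmix (r : Site (3 + 1)) κ β m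
  have hCs' : Summable (fun m : Site (3 + 1) => |wM2 3 L 0| * C * Real.exp (-δ * l1 (translate T (((L : ℕ) : ℤ) • β.1) m - (r : Site (3 + 1))))) :=
    (summable_exp_l1_translate T hδ (r : Site (3 + 1)) (((L : ℕ) : ℤ) • β.1)).1.mul_left _
  exact (perZ_dper_tsum_of_biLoc T hW' (fun m => by positivity) hδ hCs' x w a b).symm

end Summit.QuantumFields.BalabanUV.Beta.FP.TowerDoorDefectTorusPieces

end
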